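import Summits.BirchSwinnertonDyer.BirchSwinnertonDyer.Theorems.ErratumRoadFiveSelfDualMemberCongruence
import Summits.BirchSwinnertonDyer.BirchSwinnertonDyer.Theorems.ErratumRoadFiveIMCDivMemberDivisibleMember
import Literature.NumberTheory.EllipticCurves.OrdinaryNewformDatumCofreeUnramified
import Literature.NumberTheory.GaloisRepresentations.LocalKroneckerWeberInertiaProofs
import HarnessLib

/-!
# Road FF at the SELF-DUAL member module `A^†_{g_m}|_{Γ_K}`: the Lemma-2.1 divisibility inputs (`hdiv`, `hglob`, `hloc`),
# unramifiedness outside `Σ ∪ S_p`, and the congruence (b†) over `Γ_K` on the `K̄`-points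

Cell `bsd-stepL`, seat `bsd-stepL-imc-p1` g24 — TWIST AUDIT of crux `ErratumThm23SigmaLe` (item stmt-BirchSwinnertonDyer-25505),
repair step (R4) (memo `HOME/imc-p1/g24/TWIST-AUDIT-25505-imc-p1-g24.md`): the member-module inputs of the Road-FF congruence
`RoadFFMember.nonempty_memberCongruence` (crux `IMCDivAtErratumDataAllR`, item stmt-BirchSwinnertonDyer-20169), re-instantiated at the
erratum's OWN module — the self-dual Tate twist `D.Δ.selfDualCofreeRepOver K` (`OrdinaryNewformDatumSelfDualTwist`) — for a Hida
member `D` of weight `k_m ≡ 2 (mod 2(p−1)p^{m−1})`. Twins, line by line, of the untwisted lemmas of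
`ErratumRoadFiveIMCDivMemberDivisible[Member]` ∕ `…MemberCongruenceB2` ∕ `OrdinaryNewformDatumCofreeUnramified` (imc-p1 g8–g9,
defn-ty1): every proof goes THROUGH the congruence — here (b†) `SelfDualTwist.exists_equivariant_equiv_selfDual[_restrict]`
(p658384) in place of (b) — or through `ρ_g(σ) = 1` — here `ε(σ) = 1` on inertia away from `p` as well
(`FramedGaloisRep.isUnramifiedAt_cyclotomic_holds`, `cyclotomicCharacter_absGaloisRestrict`). Theorems only (0 def ∕ 0 fact ∕ 0 sorry).

* §1 `selfDualCofreeRepOver_apply_eq_self_of_mem_absInertia`, `selfDualCofreeRepOver_localMap_inr_apply_eq_self` (the `hunr` input of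
  `SkinnerUrban2014.moduleFinite_XBig_of_lemma319`), `hunr_selfDual`;
* §2 `hdiv_selfDual`;
* §3 `exists_torsionCongruence_baseChange_selfDual` — (b†) over `Γ_K` against `(ρ_{E_K,p} ⊗ 1)` on `E_K(K̄)[p^∞] ⊗ 𝒪_m`;
* §4 `forall_fixed_primary_eq_zero_selfDual`, `hglob_selfDual[_erratum]`, `hloc_selfDual[_erratum]`.

[cite: Castella2018Erratum, §2 (p. 2: the self-dual Tate twist `A_g`), Lemma 2.1 and its proof (p. 2), proof of Thm. 1.1 (a)(b)(d) (p. 4)]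
[cite: Skinner2016PacificMC, §2.3, §3.1 (b)(d) (p. 192)]
-/

set_option autoImplicit false

noncomputable section

-- D-0017: single-problem summit, the namespace repeats the problem name by design.
set_option linter.dupNamespace false

open scoped TensorProduct Classical

open PowerSeries Field IsDedekindDomain NumberField
open Literature.NumberTheory.GaloisRepresentations Literature.NumberTheory.EllipticCurves
  Literature.NumberTheory.EllipticCurves.ModularForms
  Literature.NumberTheory.EllipticCurves.BigRepModule Literature.NumberTheory.EllipticCurves.BigGaloisRep
  Literature.NumberTheory.EllipticCurves.GreenbergSelmer Literature.NumberTheory.EllipticCurves.Skinner2016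
  WeierstrassCurve
open Summit.BirchSwinnertonDyer.Rank1Residual.X11b Summit.BirchSwinnertonDyer.Rank1Residual.X11b.RoadFFMember

namespace Summit.BirchSwinnertonDyer.BirchSwinnertonDyer.Theorems.SelfDualTwist

/-! ### §1 Unramifiedness of `A_g^†` away from `M p` -/

section Unramified

variable {M : ℕ} {k : ℤ} {g : CuspForm (CongruenceSubgroup.Gamma0 M) k} {p : ℕ} [Fact p.Prime]
  {ι : coeffField g →+* PadicAlgCl p} (Δ : OrdinaryNewformDatum g p ι)
  (K : Type) [Field K] [NumberField K]

/-- An element `τ ∈ Γ_ℚ` with `ρ_g(τ) = 1` and `ε(τ) = 1` has `T_g^†(τ) = 1` (`T_g^† = T_g ⊗ ε^{1−k/2}`).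
[cite: Castella2018Erratum, §2 (p. 2, the self-dual Tate twist)] -/
theorem selfDualRep_apply_eq_one {τ : absoluteGaloisGroup ℚ} (hτ : Δ.ρ τ = 1)
    (hε : GaloisRep.cyclotomicCharacter ℚ p τ = 1) : Δ.selfDualRep τ = 1 := by
  have hχ : selfDualTwistChar ι τ = 1 := by
    rw [selfDualTwistChar_apply, hε, map_one, one_zpow]
  rw [OrdinaryNewformDatum.selfDualRep_apply, hχ, hτ, map_one, one_mul]

/-- An element `τ ∈ Γ_ℚ` with `T_g^†(τ) = 1` acts trivially on `A_g^† = Fⁿ/𝒪ⁿ`.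
[cite: Castella2018Erratum, §2 (p. 2, "`A_g := V_g/T_g`")] -/
theorem selfDualCofreeRep_apply_eq_self_of_apply_eq_one {τ : absoluteGaloisGroup ℚ} (hτ : Δ.selfDualRep τ = 1)
    (a : Cofree Δ.selfDualRep (padicCoeffField ι)) : Δ.selfDualCofreeRep τ a = a := by
  obtain ⟨x, rfl⟩ := cofreeMk_surjective (padicCoeffField ι) Δ.selfDualRep a
  rw [OrdinaryNewformDatum.selfDualCofreeRep_apply, smul_cofreeMk, fracRepresentation_apply_apply, hτ, Units.val_one,
    Matrix.map_one _ (map_zero _) (map_one _), Matrix.one_mulVec]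

/-- **`A_g^†|_{Γ_K}` is unramified at every finite place `w ∤ M p` of `K`**: the inertia group `I_{K_w}`, restricted to `Γ_K`, acts
trivially on `A_g^†` — `ρ_g` is unramified at the prime `ℓ ∤ Mp` below `w` (`Δ.charpoly`, `FramedGaloisRep.isUnramifiedAt_restrictField`,
`inertia_adicCompletionPrime_eq_map_absInertia`), and so is the cyclotomic character (`FramedGaloisRep.isUnramifiedAt_cyclotomic_holds`,
moved along `Γ_K → Γ_ℚ` by `cyclotomicCharacter_absGaloisRestrict`). Twin of `cofreeRepOver_apply_eq_self_of_mem_absInertia`.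
[cite: EmertonPollackWeston2006, §3.1 (p. 17: `ρ_f` unramified at `ℓ ∤ Np`)] [cite: SerreAbelianLadic1968, Ch. I §1.2 (the cyclotomic character is unramified away from `ℓ`)]
[cite: Castella2018Erratum, Lemma 2.1 (p. 2, "Σ contains all primes `v ∤ p` where `T_g` is ramified")] -/
theorem selfDualCofreeRepOver_apply_eq_self_of_mem_absInertia (w : HeightOneSpectrum (𝓞 K))
    (hMw : ((M : ℕ) : 𝓞 K) ∉ w.asIdeal) (hpw : ((p : ℕ) : 𝓞 K) ∉ w.asIdeal)
    {σ : absoluteGaloisGroup (w.adicCompletion K)} (hσ : σ ∈ absInertia (w.adicCompletion K))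
    (a : Cofree Δ.selfDualRep (padicCoeffField ι)) :
    Δ.selfDualCofreeRepOver K (absGaloisRestrict K (w.adicCompletion K) σ) a = a := by
  -- the place `v` of `ℚ` below `w` and its prime `ℓ`
  set v : HeightOneSpectrum (𝓞 ℚ) := w.under (𝓞 ℚ) with hv
  have hvw : w.asIdeal.under (𝓞 ℚ) = v.asIdeal := rfl
  have hℓv := Literature.NumberTheory.EllipticCurves.natCast_primesEquiv_mem_asIdeal v
  have hℓw : (((Rat.HeightOneSpectrum.primesEquiv v : Nat.Primes) : ℕ) : 𝓞 K) ∈ w.asIdeal := by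
    have h : algebraMap (𝓞 ℚ) (𝓞 K) (((Rat.HeightOneSpectrum.primesEquiv v : Nat.Primes) : ℕ) : 𝓞 ℚ) ∈
        w.asIdeal := by
      rw [← Ideal.mem_comap]; exact hℓv
    rwa [map_natCast] at h
  have hℓM : ¬ ((Rat.HeightOneSpectrum.primesEquiv v : Nat.Primes) : ℕ) ∣ M := by
    rintro ⟨c, hc⟩
    exact hMw (by rw [hc, Nat.cast_mul]; exact w.asIdeal.mul_mem_right _ hℓw)
  have hℓp : ((Rat.HeightOneSpectrum.primesEquiv v : Nat.Primes) : ℕ) ≠ p := by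
    rintro h
    exact hpw (h ▸ hℓw)
  -- `res(σ) ∈ I_{𝔓₀}` for the chosen prime `𝔓₀ ∣ w`
  have hmem : absGaloisRestrict K (w.adicCompletion K) σ ∈
      (adicCompletionPrime K w).inertia (absoluteGaloisGroup K) := by
    rw [inertia_adicCompletionPrime_eq_map_absInertia]
    exact Subgroup.mem_map_of_mem _ hσ
  -- `ρ_g|_{Γ_K}` is unramified at `w`, hence kills `res(σ)`
  have hunr : (Δ.ρ.restrictField K).IsUnramifiedAt w :=
    Δ.ρ.isUnramifiedAt_restrictField hvw (Δ.charpoly v hℓM hℓp).1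
  have h1 : (Δ.ρ.restrictField K) (absGaloisRestrict K (w.adicCompletion K) σ) = 1 :=
    hunr _ (adicCompletionPrime_mem_primesAbove K w) _ hmem
  rw [FramedGaloisRep.restrictField_apply] at h1
  -- so does the cyclotomic character: `ε_K(res σ) = 1` (unramified at `w ∤ p`), and `ε_ℚ ∘ res = ε_K`
  have h2K : GaloisRep.cyclotomicCharacter K p (absGaloisRestrict K (w.adicCompletion K) σ) = 1 := by
    have h' := FramedGaloisRep.det_cyclotomic_apply K p (absGaloisRestrict K (w.adicCompletion K) σ)
    rw [FramedRep.det_apply, FramedGaloisRep.isUnramifiedAt_cyclotomic_holds K p hpw _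
      (adicCompletionPrime_mem_primesAbove K w) _ hmem, map_one] at h'
    exact h'.symm
  haveI : NeZero (p : ℚ) := ⟨Nat.cast_ne_zero.2 (Fact.out : p.Prime).ne_zero⟩
  have h2 : GaloisRep.cyclotomicCharacter ℚ p (absGaloisRestrict ℚ K (absGaloisRestrict K (w.adicCompletion K) σ)) = 1 := by
    rw [cyclotomicCharacter_absGaloisRestrict ℚ K p, h2K]
  rw [ContinuousRep.restrict_apply]
  exact selfDualCofreeRep_apply_eq_self_of_apply_eq_one Δ (selfDualRep_apply_eq_one Δ h1 h2) a

/-- **The `hunr` hypothesis of the typed [SU14] Lemma 3.1.9 (`SkinnerUrban2014.moduleFinite_XBig_of_lemma319`) for `A_g^†|_{Γ_K}`**, for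
any set `Σ` of places outside which `M` is a unit: at every finite `w ∉ Σ` with `w ∤ p`, the inertia group (`BigGaloisRep.localMap K
(Sum.inr w)`) acts trivially. Twin of `OrdinaryNewformDatum.cofreeRepOver_localMap_inr_apply_eq_self`.
[cite: Castella2018Erratum, Lemma 2.1 (p. 2, "Σ contains all primes `v ∤ p` where `T_g` is ramified")] -/
theorem selfDualCofreeRepOver_localMap_inr_apply_eq_self (S : Set (HeightOneSpectrum (𝓞 K)))
    (hSM : ∀ w : HeightOneSpectrum (𝓞 K), w ∉ S → ((M : ℕ) : 𝓞 K) ∉ w.asIdeal) :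
    ∀ w : HeightOneSpectrum (𝓞 K), w ∉ S → ((p : ℕ) : 𝓞 K) ∉ w.asIdeal →
      ∀ (σ : LocalGroup K (Sum.inr w)) (a : Cofree Δ.selfDualRep (padicCoeffField ι)),
        Δ.selfDualCofreeRepOver K (localMap K (Sum.inr w) σ) a = a :=
  fun w hw hpw σ a ↦
    selfDualCofreeRepOver_apply_eq_self_of_mem_absInertia Δ K w (hSM w hw) hpw (σ := inertiaIncl K w σ) σ.2 a

/-- **The unramifiedness input `hunr` of `BigRep.divisibleInvariants_localMap_strictSet` for `A_g^†|_{Γ_K}`**: at every finite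
`w ∉ Σ` with `w ∤ p`, `I_{K_w}` acts trivially (twin of `RoadFFMember.hunr_cofreeRepOver`).
[cite: Castella2018Erratum, Lemma 2.1 (p. 2, "Σ contains all primes `v ∤ p` where `T_g` is ramified")] -/
theorem hunr_selfDual (S : Set (HeightOneSpectrum (𝓞 K)))
    (hSM : ∀ w : HeightOneSpectrum (𝓞 K), w ∉ S → ((M : ℕ) : 𝓞 K) ∉ w.asIdeal) :
    ∀ w : HeightOneSpectrum (𝓞 K), w ∉ S → ((p : ℕ) : 𝓞 K) ∉ w.asIdeal →
      ∀ σ : absoluteGaloisGroup (w.adicCompletion K), σ ∈ absInertia (w.adicCompletion K) →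
        ∀ a : Cofree Δ.selfDualRep (padicCoeffField ι),
          Δ.selfDualCofreeRepOver K (absGaloisRestrict K (w.adicCompletion K) σ) a = a :=
  fun w hw hpw _σ hσ a => selfDualCofreeRepOver_apply_eq_self_of_mem_absInertia Δ K w (hSM w hw) hpw hσ a

/-! ### §2 `hdiv` -/

/-- **`hdiv` for `M_g^† = AnticyclotomicBigGaloisRep κ (A_g^†|_{Γ_K})`**: `Φ ↦ C(p) • Φ` is onto, `A_g^† = Fⁿ/𝒪ⁿ` being `p`-divisible
(the module does not see the twist). Twin of `RoadFFMember.hdiv_cofreeRepOver`.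
[cite: Skinner2016PacificMC, §2.3, proof of Lemma 2.3.1 (p. 180)] [cite: Castella2018Erratum, §2 (p. 2, `M_g`)] -/
theorem hdiv_selfDual :
    Function.Surjective fun Φ : BigRepModule (padicCoeffIntegers ι) p (Cofree Δ.selfDualRep (padicCoeffField ι)) =>
      (C (p : padicCoeffIntegers ι) : PowerSeries (padicCoeffIntegers ι)) • Φ :=
  BigRep.C_smul_surjective fun a _ =>
    cofree_divisible (padicCoeffField ι) Δ.selfDualRep (Fact.out : p.Prime).ne_zero a

end Unramified

/-! ### §3 The congruence (b†) over `Γ_K` on the `K̄`-points -/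

section Member

variable {W : WeierstrassCurve ℚ} [W.IsGloballyMinimal] {p : ℕ} [Fact p.Prime] {m : ℕ}
  (D : HidaCongruentMember W p m) (K : Type) [Field K] [NumberField K]
  [Module.Free ℤ_[p] (padicCoeffIntegers D.ι)]

omit [Module.Free ℤ_[p] (padicCoeffIntegers D.ι)] in
/-- **The Hida congruence (b†) OVER `Γ_K` ON THE `K̄`-POINTS** — the hypothesis `hb` of `RoadFFMember.nonempty_memberCongruence` at
`ρ𝒪 := ((W.baseChange K).primaryTorsionGaloisRep p).extendScalars 𝒪_m`, `ρg := D.Δ.selfDualCofreeRepOver K`, for a member of weight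
`k_m ≡ 2 (mod 2(p−1)p^{m−1})`: an `𝒪_m`-linear `e : A^†_{g_m}[p^m] ≃ (E_K(K̄)[p^∞] ⊗ 𝒪_m)[p^m]` with
`e(σ·a) = (ρ_{E_K,p} ⊗ 1)(σ)(e a)` for `σ ∈ Γ_K`. Assembled exactly as the untwisted `exists_torsionCongruence_baseChange` from (b†)
(`exists_equivariant_equiv_selfDual_restrict`), `E(ℚ̄)[p^∞] ≃ E_K(K̄)[p^∞]` (`exists_primaryTorsion_baseChange_equiv`),
`exists_coeffExtension_congr` and `exists_torsionBy_congr`. [cite: Skinner2016PacificMC, §3.1 (b) (p. 192)]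
[cite: Castella2018Erratum, §2 (p. 2) and proof of Thm. 1.1, (a)(b) and Lemma 2.1 (pp. 2, 4)] -/
theorem exists_torsionCongruence_baseChange_selfDual (hm : 1 ≤ m)
    (hk : (2 * ((p : ℤ) - 1) * (p : ℤ) ^ (m - 1)) ∣ D.k - 2) :
    ∃ e : Submodule.torsionBy (padicCoeffIntegers D.ι) (Cofree D.Δ.selfDualRep (padicCoeffField D.ι))
          ((p : padicCoeffIntegers D.ι) ^ m) ≃ₗ[padicCoeffIntegers D.ι]
        Submodule.torsionBy (padicCoeffIntegers D.ι)
          (CoeffExtension ℤ_[p] (padicCoeffIntegers D.ι) (PrimaryTorsion (geomPoints (W.baseChange K)) p))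
          ((p : padicCoeffIntegers D.ι) ^ m),
      ∀ (g : absoluteGaloisGroup K)
        (a : Submodule.torsionBy (padicCoeffIntegers D.ι) (Cofree D.Δ.selfDualRep (padicCoeffField D.ι))
          ((p : padicCoeffIntegers D.ι) ^ m)),
        (e (TorsionControl.torsionRep (D.Δ.selfDualCofreeRepOver K) ((p : padicCoeffIntegers D.ι) ^ m) g a) :
            CoeffExtension ℤ_[p] (padicCoeffIntegers D.ι) (PrimaryTorsion (geomPoints (W.baseChange K)) p)) =
          ContinuousRep.extendScalars (R := ℤ_[p]) (G := absoluteGaloisGroup K)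
            (A := PrimaryTorsion (geomPoints (W.baseChange K)) p) (padicCoeffIntegers D.ι)
            ((W.baseChange K).primaryTorsionGaloisRep p) g
            (e a : CoeffExtension ℤ_[p] (padicCoeffIntegers D.ι)
              (PrimaryTorsion (geomPoints (W.baseChange K)) p)) := by
  -- (`obtain` on these existentials sends `isDefEq` into a timeout; `Exists.elim` does not.)
  refine (exists_primaryTorsion_baseChange_equiv W p K).elim fun θ hθ => ?_
  refine (exists_coeffExtension_congr (R := ℤ_[p]) (padicCoeffIntegers D.ι)
    (A := PrimaryTorsion (geomPoints W) p) (B := PrimaryTorsion (geomPoints (W.baseChange K)) p)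
    (G := absoluteGaloisGroup K)
    ((W.primaryTorsionGaloisRep p).restrict (absGaloisRestrict ℚ K)) ((W.baseChange K).primaryTorsionGaloisRep p)
    θ (fun g P => by rw [ContinuousRep.restrict_apply]; exact hθ g P)).elim fun Θ hΘ' => ?_
  obtain ⟨-, hΘ⟩ := hΘ'
  refine (exists_torsionBy_congr (padicCoeffIntegers D.ι) Θ ((p : padicCoeffIntegers D.ι) ^ m)).elim
    fun eΘ heΘ => ?_
  refine (exists_equivariant_equiv_selfDual_restrict D hm hk K).elim fun e₀ he₀ => ?_
  -- the `E`-side actions agree: `(ρ_{E,p} ⊗ 1)|_{Γ_K} = (ρ_{E,p}|_{Γ_K}) ⊗ 1` pointwise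
  have hA : ∀ (g : absoluteGaloisGroup K) (x : CurveCoeffModule (p := p) W D.ι),
      ((curveCoeffRep W D.ι).restrict (absGaloisRestrict ℚ K)) g x =
        ContinuousRep.extendScalars (R := ℤ_[p]) (G := absoluteGaloisGroup K)
          (A := PrimaryTorsion (geomPoints W) p) (padicCoeffIntegers D.ι)
          ((W.primaryTorsionGaloisRep p).restrict (absGaloisRestrict ℚ K)) g x := fun g x => by
    rw [ContinuousRep.restrict_apply (curveCoeffRep W D.ι) (absGaloisRestrict ℚ K) g, curveCoeffRep_def,
      ContinuousRep.extendScalars_restrict_apply]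
  -- (b†)'s equivariance, read through the kernel's `TorsionControl.torsionRep` (same body as `BigGaloisRep.torsionRep`)
  have he₀' : ∀ (g : absoluteGaloisGroup K)
      (a : Submodule.torsionBy (padicCoeffIntegers D.ι) (Cofree D.Δ.selfDualRep (padicCoeffField D.ι))
        ((p : padicCoeffIntegers D.ι) ^ m)),
      ((e₀ (TorsionControl.torsionRep (D.Δ.selfDualCofreeRepOver K) ((p : padicCoeffIntegers D.ι) ^ m) g a)) :
          CurveCoeffModule (p := p) W D.ι) =
        ((curveCoeffRep W D.ι).restrict (absGaloisRestrict ℚ K)) g (e₀ a : CurveCoeffModule (p := p) W D.ι) :=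
    fun g a => he₀ g a
  -- `(e₀ ≫ eΘ) x = eΘ (e₀ x)` on underlying elements
  have htr : ∀ x : Submodule.torsionBy (padicCoeffIntegers D.ι) (Cofree D.Δ.selfDualRep (padicCoeffField D.ι))
        ((p : padicCoeffIntegers D.ι) ^ m),
      (((e₀.trans eΘ) x :
          Submodule.torsionBy (padicCoeffIntegers D.ι)
            (CoeffExtension ℤ_[p] (padicCoeffIntegers D.ι) (PrimaryTorsion (geomPoints (W.baseChange K)) p))
            ((p : padicCoeffIntegers D.ι) ^ m)) :
          CoeffExtension ℤ_[p] (padicCoeffIntegers D.ι) (PrimaryTorsion (geomPoints (W.baseChange K)) p)) =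
        Θ (e₀ x : CurveCoeffModule (p := p) W D.ι) := fun x =>
    (congrArg Subtype.val (LinearEquiv.trans_apply (e₁₂ := e₀) (e₂₃ := eΘ) x)).trans (heΘ (e₀ x))
  exact ⟨e₀.trans eΘ, fun g a =>
    (htr _).trans (((congrArg Θ (he₀' g a)).trans ((congrArg Θ (hA g _)).trans (hΘ g _))).trans
      (congrArg _ (htr a).symm))⟩

/-! ### §4 `hglob` and `hloc` for `M_g^†` through (b†) -/

/-- **No nonzero fixed `p`-power torsion in `A^†_{g_m}|_{Γ_K}`** (for a family `(g i)` in `Γ_K`) from "no nonzero `(g i)`-fixed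
geometric `p`-torsion point of `E_K`", through (b†). Twin of `RoadFFMember.forall_fixed_primary_eq_zero_cofreeRepOver`.
[cite: Castella2018Erratum, proof of Thm. 1.1, (b)(d) and Lemma 2.1 (pp. 2, 4)] [cite: Skinner2016PacificMC, §3.1 (b), (d) (p. 192)] -/
theorem forall_fixed_primary_eq_zero_selfDual (hm : 1 ≤ m)
    (hk : (2 * ((p : ℤ) - 1) * (p : ℤ) ^ (m - 1)) ∣ D.k - 2) {ι' : Type*}
    (g : ι' → absoluteGaloisGroup K)
    (h0 : ∀ P : (W.baseChange K).geomPoints, (∀ i, g i • P = P) → p • P = 0 → P = 0) :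
    ∀ a : Cofree D.Δ.selfDualRep (padicCoeffField D.ι), (∀ i, D.Δ.selfDualCofreeRepOver K (g i) a = a) →
      (∃ k : ℕ, p ^ k • a = 0) → a = 0 := by
  refine (exists_torsionCongruence_baseChange_selfDual D K hm hk).elim fun e he => ?_
  exact BigRep.forall_fixed_primary_eq_zero_of_equiv_pow (D.Δ.selfDualCofreeRepOver K)
    (ContinuousRep.extendScalars (R := ℤ_[p]) (G := absoluteGaloisGroup K)
      (A := PrimaryTorsion (W.baseChange K).geomPoints p) (padicCoeffIntegers D.ι)
      ((W.baseChange K).primaryTorsionGaloisRep p)) hm e he g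
    (forall_fixed_torsion_eq_zero_extendScalars_of_geomPoints (padicCoeffIntegers D.ι) (W.baseChange K) g h0)

variable [TopologicalSpace (PowerSeries (padicCoeffIntegers D.ι))]
  [ContinuousSMul (PowerSeries (padicCoeffIntegers D.ι))
    (BigRepModule (padicCoeffIntegers D.ι) p (Cofree D.Δ.selfDualRep (padicCoeffField D.ι)))]

/-- **`hglob` for `M^†_{g_m}`** from "no nonzero `Γ_K`-fixed geometric `p`-torsion of `E_K`", through (b†).
Twin of `RoadFFMember.hglob_cofreeRepOver`. [cite: Castella2018Erratum, Lemma 2.1, proof (p. 2: "H⁰(K, M_g) = 0")] -/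
theorem hglob_selfDual (hm : 1 ≤ m) (hk : (2 * ((p : ℤ) - 1) * (p : ℤ) ^ (m - 1)) ∣ D.k - 2) (κ : ZpExtension K p)
    (hK : ∀ P : (W.baseChange K).geomPoints, (∀ σ : absoluteGaloisGroup K, σ • P = P) → p • P = 0 → P = 0) :
    ∀ m' : ℕ, 1 ≤ m' → ∀ x ∈ (AnticyclotomicBigGaloisRep κ (D.Δ.selfDualCofreeRepOver K)).toTopRep.ρ.invariants,
      ∃ x' ∈ (AnticyclotomicBigGaloisRep κ (D.Δ.selfDualCofreeRepOver K)).toTopRep.ρ.invariants,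
        (C (p : padicCoeffIntegers D.ι) : PowerSeries (padicCoeffIntegers D.ι)) ^ m' • x' = x :=
  BigRep.divisibleInvariants_anticyclotomicBigGaloisRep κ _
    (forall_fixed_primary_eq_zero_selfDual D K hm hk (fun σ : absoluteGaloisGroup K => σ) hK)

/-- **`hloc` for `M^†_{g_m}`** at `(localMap K, strictSet p 𝔮 Σ)` from "no nonzero `Γ_{K_𝔮}`-fixed geometric `p`-torsion of `E_K`"
(through (b†)), unramifiedness of `A^†_{g_m}` outside `Σ ∪ S_p` (`hunr_selfDual`) and `p`-divisibility. Twin of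
`RoadFFMember.hloc_cofreeRepOver`. [cite: Castella2018Erratum, Lemma 2.1 and its proof (p. 2)] -/
theorem hloc_selfDual (hm : 1 ≤ m) (hk : (2 * ((p : ℤ) - 1) * (p : ℤ) ^ (m - 1)) ∣ D.k - 2) (κ : ZpExtension K p)
    (𝔮 : HeightOneSpectrum (𝓞 K)) (S : Set (HeightOneSpectrum (𝓞 K)))
    (h𝔮 : ∀ P : (W.baseChange K).geomPoints, (∀ σ : absoluteGaloisGroup (𝔮.adicCompletion K),
        absGaloisRestrict K (𝔮.adicCompletion K) σ • P = P) → p • P = 0 → P = 0)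
    (hSM : ∀ w : HeightOneSpectrum (𝓞 K), w ∉ S → ((W.conductorNorm ℤ / p : ℕ) : 𝓞 K) ∉ w.asIdeal) :
    ∀ m' : ℕ, 1 ≤ m' → ∀ v ∈ strictSet p 𝔮 S,
      ∀ x ∈ (((AnticyclotomicBigGaloisRep κ (D.Δ.selfDualCofreeRepOver K)).restrict (localMap K v)).toTopRep).ρ.invariants,
        ∃ x' ∈ (((AnticyclotomicBigGaloisRep κ (D.Δ.selfDualCofreeRepOver K)).restrict
            (localMap K v)).toTopRep).ρ.invariants,
          (C (p : padicCoeffIntegers D.ι) : PowerSeries (padicCoeffIntegers D.ι)) ^ m' • x' = x :=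
  BigRep.divisibleInvariants_localMap_strictSet κ _ 𝔮 S
    (fun a _ => cofree_divisible (padicCoeffField D.ι) D.Δ.selfDualRep (Fact.out : p.Prime).ne_zero a)
    (forall_fixed_primary_eq_zero_selfDual D K hm hk
      (fun σ : absoluteGaloisGroup (𝔮.adicCompletion K) => absGaloisRestrict K (𝔮.adicCompletion K) σ) h𝔮)
    (hunr_selfDual D.Δ K S hSM)

section Erratum

variable [W.IsElliptic]

/-- **`hglob` for the self-dual member at the erratum data, inputs discharged**: `E[p]` irreducible, `K` imaginary quadratic
(`BigRep.hglob_geomPoints_of_irr`), through (b†). Twin of `RoadFFMember.hglob_cofreeRepOver_erratum`.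
[cite: Castella2018Erratum, Thm. 1.1 and Lemma 2.1, proof (p. 2)] -/
theorem hglob_selfDual_erratum (hm : 1 ≤ m) (hk : (2 * ((p : ℤ) - 1) * (p : ℤ) ^ (m - 1)) ∣ D.k - 2)
    (κ : ZpExtension K p) (hK : IsImaginaryQuadratic K) (hirr : W.HasIrreducibleModPGaloisRep p) :
    ∀ m' : ℕ, 1 ≤ m' → ∀ x ∈ (AnticyclotomicBigGaloisRep κ (D.Δ.selfDualCofreeRepOver K)).toTopRep.ρ.invariants,
      ∃ x' ∈ (AnticyclotomicBigGaloisRep κ (D.Δ.selfDualCofreeRepOver K)).toTopRep.ρ.invariants,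
        (C (p : padicCoeffIntegers D.ι) : PowerSeries (padicCoeffIntegers D.ι)) ^ m' • x' = x :=
  hglob_selfDual D K hm hk κ (BigRep.hglob_geomPoints_of_irr W p hK hirr)

omit [W.IsElliptic] in
/-- **`hloc` for the self-dual member at the erratum data, inputs discharged**: (iv) `E(ℚ_p)[p] = 0` with `K_𝔭 ↪ ℚ_p`
(`BigRep.hdec_geomPoints_of_padicTorsion`), `Σ ∋` every `w ∣ N`, `p ∣ N`, through (b†). Twin of
`RoadFFMember.hloc_cofreeRepOver_erratum`. [cite: Castella2018Erratum, Thm. 1.1 (iv), Lemma 2.1 and its proof (pp. 1–2)] -/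
theorem hloc_selfDual_erratum (hm : 1 ≤ m) (hk : (2 * ((p : ℤ) - 1) * (p : ℤ) ^ (m - 1)) ∣ D.k - 2)
    (κ : ZpExtension K p) (𝔭 : HeightOneSpectrum (𝓞 K))
    (φ : 𝔭.adicCompletion K →+* ℚ_[p]) (S : Set (HeightOneSpectrum (𝓞 K)))
    (hiv : ∀ Q : (W.baseChange ℚ_[p]).toAffine.Point, p • Q = 0 → Q = 0)
    (hSN : ∀ w : HeightOneSpectrum (𝓞 K), w ∉ S → ((W.conductorNorm ℤ : ℕ) : 𝓞 K) ∉ w.asIdeal)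
    (hpN : p ∣ W.conductorNorm ℤ) :
    ∀ m' : ℕ, 1 ≤ m' → ∀ v ∈ strictSet p 𝔭 S,
      ∀ x ∈ (((AnticyclotomicBigGaloisRep κ (D.Δ.selfDualCofreeRepOver K)).restrict (localMap K v)).toTopRep).ρ.invariants,
        ∃ x' ∈ (((AnticyclotomicBigGaloisRep κ (D.Δ.selfDualCofreeRepOver K)).restrict
            (localMap K v)).toTopRep).ρ.invariants,
          (C (p : padicCoeffIntegers D.ι) : PowerSeries (padicCoeffIntegers D.ι)) ^ m' • x' = x :=
  hloc_selfDual D K hm hk κ 𝔭 S (BigRep.hdec_geomPoints_of_padicTorsion W p K 𝔭 φ hiv)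
    (conductorNorm_div_notMem_of_conductorNorm_notMem K S hSN hpN)

end Erratum

end Member

end Summit.BirchSwinnertonDyer.BirchSwinnertonDyer.Theorems.SelfDualTwist

end
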